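import Literature.Algebra.GroupRings.MaschkeTheoremGeneralRing
import Mathlib.Algebra.Module.Projective
import Mathlib.LinearAlgebra.Finsupp.LinearCombination
import HarnessLib

/-!
# Lam §6 Exercise 6.3: Maschke averaging for projectivity — `k`-split ⟹ `kG`-split, `k`-projective ⟹ `kG`-projective

[cite: Lam2001FirstCourse, §6 Exercise 6.3, p. 97]

Lam, *A First Course in Noncommutative Rings*, Exercises for §6 (p. 97; p0109 of the held scan):

**Ex. 6.3.** Let `G` be a finite group whose order is a unit in a ring `k`, and let `W ⊆ V` be left `kG`-modules.
(1) If `W` is a direct summand of `V` as `k`-modules, show that `W` is a direct summand of `V` as `kG`-modules.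
(2) If `V` is projective as a `k`-module, show that `V` is projective as a `kG`-module.

Part (1) is the tree's `exists_isCompl_of_isUnit_card` (file `MaschkeTheoremGeneralRing`, the averaging of the proof of (6.1)). This
file adds the «section» form of the averaging (`exists_equivariant_section_of_isUnit_card`: a `kG`-epimorphism with a `k`-linear section
has a `kG`-linear section) and part (2) (`projective_of_isUnit_card`): the canonical presentation `π : ⊕_V kG ↠ V` splits over `k` when
`V` is `k`-projective, hence over `kG`, so `V` is a direct summand of a free `kG`-module.

## References

* [Lam2001FirstCourse] T. Y. Lam, *A First Course in Noncommutative Rings*, 2nd ed., Graduate Texts in Mathematics 131, Springer, 2001,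
  §6 Exercise 6.3, p. 97 (held scan `book:lamnd-first-course-noncommutative-rings`, p0109); proof of Thm. (6.1), pp. 79–80.
-/

universe u v v' w

namespace Literature.Algebra.GroupRings

open MonoidAlgebra

variable {k : Type u} [Ring k] {G : Type w} [Group G] [Finite G]
variable {V : Type v} [AddCommGroup V] [Module k V] [Module (MonoidAlgebra k G) V]
variable {F : Type v'} [AddCommGroup F] [Module k F] [Module (MonoidAlgebra k G) F] [IsScalarTower k (MonoidAlgebra k G) F]

/-- **Ex. 6.3 (1), section form: if `|G|·1 ∈ k×`, a `kG`-linear map `π : F → V` admitting a `k`-linear section admits a `kG`-linear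
section** (the kernel of `π` has a `k`-complement, hence a `kG`-complement `C` by part (1), and `π|_C : C ≅ V`).
[cite: Lam2001FirstCourse, §6 Exercise 6.3 (1)] -/
theorem exists_equivariant_section_of_isUnit_card (hcard : IsUnit (Nat.card G : k)) (π : F →ₗ[MonoidAlgebra k G] V) (s : V →ₗ[k] F)
    (hs : ∀ v : V, π (s v) = v) : ∃ s' : V →ₗ[MonoidAlgebra k G] F, ∀ v : V, π (s' v) = v := by
  -- `range s` is a `k`-complement of `ker π`
  have hc : IsCompl ((LinearMap.ker π).restrictScalars k) (LinearMap.range s) := by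
    refine ⟨Submodule.disjoint_def.2 fun x hx hx' ↦ ?_, codisjoint_iff.2 (eq_top_iff.2 fun x _ ↦ ?_)⟩
    · obtain ⟨v, rfl⟩ := LinearMap.mem_range.1 hx'
      have h1 : π (s v) = 0 := hx
      rw [hs] at h1
      rw [h1, map_zero]
    · refine Submodule.mem_sup.2 ⟨x - s (π x), ?_, s (π x), LinearMap.mem_range_self s _, sub_add_cancel x _⟩
      change π (x - s (π x)) = 0
      rw [map_sub, hs, sub_self]
  -- hence a `kG`-complement `C`
  obtain ⟨C, hC⟩ := exists_isCompl_of_isUnit_card k G hcard (LinearMap.ker π) ⟨LinearMap.range s, hc⟩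
  -- `π|_C : C → V` is bijective
  have hinj : Function.Injective (π.domRestrict C) := fun x y hxy ↦ by
    have h0 : ((x - y : C) : F) ∈ LinearMap.ker π := by
      rw [LinearMap.mem_ker, Submodule.coe_sub, map_sub]
      exact sub_eq_zero.2 hxy
    have h1 : ((x - y : C) : F) ∈ LinearMap.ker π ⊓ C := Submodule.mem_inf.2 ⟨h0, (x - y).2⟩
    rw [hC.inf_eq_bot, Submodule.mem_bot, Submodule.coe_eq_zero] at h1
    exact sub_eq_zero.1 h1
  have hsurj : Function.Surjective (π.domRestrict C) := fun v ↦ by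
    have hm : s v ∈ LinearMap.ker π ⊔ C := by rw [hC.sup_eq_top]; exact Submodule.mem_top
    obtain ⟨m₁, hm₁, m₂, hm₂, h⟩ := Submodule.mem_sup.1 hm
    refine ⟨⟨m₂, hm₂⟩, ?_⟩
    rw [LinearMap.domRestrict_apply]
    have h2 := congrArg π h
    rwa [map_add, LinearMap.mem_ker.1 hm₁, zero_add, hs] at h2
  let e : C ≃ₗ[MonoidAlgebra k G] V := LinearEquiv.ofBijective (π.domRestrict C) ⟨hinj, hsurj⟩
  refine ⟨C.subtype ∘ₗ (e.symm : V →ₗ[MonoidAlgebra k G] C), fun v ↦ ?_⟩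
  have h1 : π (C.subtype (e.symm v)) = e (e.symm v) := rfl
  rw [LinearMap.comp_apply, LinearEquiv.coe_coe, h1, LinearEquiv.apply_symm_apply]

/-- **LAM Exercise 6.3 (2): if `|G|·1 ∈ k×` and the `kG`-module `V` is projective as a `k`-module, then `V` is projective as a
`kG`-module** — the presentation `⊕_V kG ↠ V` has a `k`-linear section (projectivity over `k`), hence a `kG`-linear one by part (1).
[cite: Lam2001FirstCourse, §6 Exercise 6.3 (2)] -/
theorem projective_of_isUnit_card (hcard : IsUnit (Nat.card G : k)) [IsScalarTower k (MonoidAlgebra k G) V] [Module.Projective k V] :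
    Module.Projective (MonoidAlgebra k G) V := by
  -- the canonical presentation `π : (V →₀ kG) ↠ V`
  let π : (V →₀ MonoidAlgebra k G) →ₗ[MonoidAlgebra k G] V := Finsupp.linearCombination (MonoidAlgebra k G) (id : V → V)
  have hπ : Function.Surjective π := Finsupp.linearCombination_id_surjective (MonoidAlgebra k G) V
  -- a `k`-linear section (projectivity of `V` over `k`)
  obtain ⟨s, hs⟩ := Module.projective_lifting_property (π.restrictScalars k) (LinearMap.id : V →ₗ[k] V) hπ
  have hs' : ∀ v : V, π (s v) = v := fun v ↦ LinearMap.congr_fun hs v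
  -- a `kG`-linear section (part (1)), so `V` is a direct summand of the free `kG`-module `V →₀ kG`
  obtain ⟨s', hs''⟩ := exists_equivariant_section_of_isUnit_card hcard π s hs'
  exact Module.Projective.of_split s' π (LinearMap.ext hs'')

end Literature.Algebra.GroupRings
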